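import Summits.ABC.StewartYu.ArchG3HalfSeparation
import Summits.ABC.StewartYu.ArchG3HalfDescent
import Summits.ABC.StewartYu.ArchG3Levels
import HarnessLib

/-!
# Cell abc-stewartyu, rung A1.L (crux r2 `ArchCoreRat`), WP-L.A parcel P-A6 (Kummer half-step), part 4: THE HALF-STEP ON THE LEVEL INVARIANT
# `(s, n) → (s+1, 0)` — from the Δ-vanishing at `|x| ≤ N` to the next family's Δ-vanishing at the odd `|x| ≤ 2N₁ − 1`

`Summits/ABC/StewartYu/ArchG3LevelStepH.lean` — cell `abc-stewartyu` (HOME `run/shared/lean/pub/abc-stewartyu/`; TRANCHE PLAN v1.2 §4′ P-A6;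
seat lp-1 g8).  Theorems on `ArchG3Setup.ArchLvInv`; no definition, no named fact.  Archimedean twin of `G3Setup.LvInvI.halfStep`
(`PadicG3LevelStepH`, seat p2-g4), composing: the smallness of `φ_{a,μ}(s/2)` at every odd `|s| ≤ 2N₁ − 1 ≤ 6N + 4` from the Δ-invariant
(`ArchG3HalfSeparation.norm_archΦ_pvΔ_half_le`), the SEPARATION by Waldschmidt's sharp Liouville inequality in `ℚ(√α₁,…,√αₙ)` under the
independence of the square classes (`halfClassVec_pvΔ_eq_zero`: every class sum vanishes), the identification of the pivot's class sum with
a value of the RE-INDEXED family `(R′, halfDiff v i₀)` at the INTEGER point `s` (`halfClassVec_pivot_eq`; `(Hasse_a Rᵢ)(s/2) = c_a (Hasse_a Rᵢ′)(s)`,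
`c_a ≠ 0`), and the change of Δ-basis to the new arguments `c′(𝔛ₖ(wᵢ) − e′ₖ)` (`archφ_pvΔ_rebase`); the new box `⌊L/2⌋`, the HALVED slab
(`w/2`, centre `γ′ = (γ − Lsum v_{i₀})/2`) and the non-vanishing of the pivot's coefficient complete the new state.

RECORD INTERFACE (hypotheses, uniform sizes as in `ArchLvInv.kstep` + per odd `s` and `(a, μ)`, `a + |μ| < T′`: a common denominator
`D s a μ` of the class sums, their total size `≤ Mb s a μ`, the Hasse weight `Wh` at `s/2`, and the inequality
`majorant of ‖φ_{a,μ}(s/2)‖ < Mb/(4·D·Mb·(∏H(αⱼ))²)^{2ⁿ}` written with `Bc ≥ #B`, `δ₀ ≥ |Λ/b_{j₀}|`).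

* `ArchLvInv.halfStep` — the new state `ArchLvInv R′ (parityClass v B i₀) (halfDiff v i₀) pv lo′ ⌊L/2⌋ P (w/2) γ′ c′ e′ {x odd, |x| ≤ 2N₁−1} T′`,
  `γ′ = (γ − Lsum v_{i₀})/2` (`|γ′| ≤ w/2`: the slab radius and centre HALVE at each level — print's `2^{−s}` in (4.27))
  for a pivot `i₀ ∈ B` with `pv i₀ ≠ 0`, `T′ + t ≤ T`.

WHAT THIS IS NOT: the record package of the half-step and the schedule across levels (`ArchG3StepPacks`/`ArchG3Schedule`); no crux moves.

## References
* Yu. V. Nesterenko, LNM 1819 (2003) — §4.3 (4.36)–(4.51), Lemma 4.4, Cor. 4.5, p. 90–95. [Nesterenko2003]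
* M. Waldschmidt, Acta Arith. 37 (1980) — Lemma 3.7 (p. 272). [Waldschmidt1980]
* K. Yu, Compositio Math. 74 (1990) — Lemma 2.5, (2.101)–(2.106); Acta Math. 211 (2013) Lemma 5.4 (the `p`-adic model). [Yu1990] [Yu2013]
-/

noncomputable section

open Finset Polynomial
open Literature.NumberTheory.Transcendental
open Literature.NumberTheory.Transcendental.CW77 (mono ev heightProd)
open Literature.NumberTheory.Transcendental.CW77.Setup (Tau tauNorm)
open scoped Nat

namespace Summit.ABC.StewartYu

namespace ArchG3Setup

variable {ι : Type*}

namespace ArchLvInv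

variable {S : ArchG3Setup} {R R' : ι → ℚ[X]} {B : Finset ι} {v : ι → Fin S.n → ℤ} {pv : ι → ℤ} {lo : Fin S.n → ℤ}
  {L : Fin S.n → ℕ} {P : ℤ} {w γ : ℝ} {c : ℤ} {e : Fin S.n → ℤ} {N T : ℕ}

/-- **THE KUMMER HALF-STEP on the archimedean invariant** (`(s, n) → (s+1, 0)`; twin of `G3Setup.LvInvI.halfStep`).
[cite: Nesterenko2003, §4.3 (4.36)–(4.51), Lemma 4.4, p. 90–95] [cite: Waldschmidt1980, Lemma 3.7 (p. 272)] -/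
theorem halfStep (h : S.ArchLvInv R B v pv lo L P w γ c e {x : ℤ | |x| ≤ (N : ℤ)} T)
    (hind : ∀ T₁ : Finset (Fin S.n), T₁.Nonempty → ¬ IsSquare (∏ j ∈ T₁, S.α j))
    {N₁ T' t : ℕ} (ht : 1 ≤ t) (hT : T' + t ≤ T) (hN₁ : 2 * N₁ ≤ 6 * N + 5)
    (ca : ℕ → ℚ) (hca : ∀ a, ca a ≠ 0)
    (hRR' : ∀ i ∈ B, ∀ (a : ℕ) (s : ℤ), (hasseDeriv a (R i)).eval ((s : ℚ) / 2) = ca a * (hasseDeriv a (R' i)).eval (s : ℚ))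
    {c' : ℤ} (hc' : c' ≠ 0) (e' : Fin S.n → ℤ)
    {Bc : ℝ} (hBc : (B.card : ℝ) ≤ Bc)
    {A : Fin S.n → ℝ} (hA : ∀ k, |S.lg k| ≤ A k)
    {Γ : Fin S.n → ℝ} (hΓ0 : ∀ k, 0 ≤ Γ k) (hΓ : ∀ i ∈ B, ∀ k, |(S.zγ (v i) k : ℝ)| ≤ Γ k)
    {PΔ : ℝ} (hPΔ0 : 0 ≤ PΔ)
    (hPΔ : ∀ (a : ℕ) (μ : Fin S.n → ℕ), a + ∑ k, μ k < T' → ∀ i ∈ B, |(S.pvΔ v pv c e μ i : ℝ)| ≤ PΔ)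
    {E : ℝ} (hE : 1 ≤ E)
    {Wd : ℝ} (hWd : ∀ i ∈ B, ∀ a < T', ∀ z : ℂ, ‖z‖ ≤ (3 * E + 1) * (2 * N + 1) + N → ‖(hw R i a).eval z‖ ≤ Wd)
    {Wn : ℝ} (hWn0 : 0 ≤ Wn)
    (hWn : ∀ i ∈ B, ∀ t₀ < T, ∀ x : ℤ, |x| ≤ (N : ℤ) → |(((hasseDeriv t₀ (R i)).eval (x : ℚ) : ℚ) : ℝ)| ≤ Wn)
    {Wh : ℝ} (hWh0 : 0 ≤ Wh)
    (hWh : ∀ i ∈ B, ∀ a < T', ∀ s : ℤ, Odd s → |s| ≤ 2 * (N₁ : ℤ) - 1 → ‖(hw R i a).eval ((s : ℂ) / 2)‖ ≤ Wh)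
    (hw0 : 0 ≤ w) {δ₀ : ℝ} (hΛ : |S.Λ / (S.b S.j₀ : ℝ)| ≤ δ₀)
    (hsmall : (L S.j₀ : ℝ) * δ₀ * (3 * N + 2) ≤ 1) {C : ℝ} (hC : 1 ≤ C)
    (D : ℤ → ℕ → (Fin S.n → ℕ) → ℕ) (hD : ∀ s a μ, 1 ≤ D s a μ)
    (hden : ∀ s : ℤ, Odd s → |s| ≤ 2 * (N₁ : ℤ) - 1 → ∀ (a : ℕ) (μ : Fin S.n → ℕ), a + ∑ k, μ k < T' →
      ∀ T₁, ∃ z : ℤ, (D s a μ : ℚ) * S.halfClassVec R v B (S.pvΔ v pv c e μ) ((a, 0) : Tau S.n) s T₁ = z)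
    (Mb : ℤ → ℕ → (Fin S.n → ℕ) → ℝ) (hMb : ∀ s a μ, 1 ≤ Mb s a μ)
    (hsum : ∀ s : ℤ, Odd s → |s| ≤ 2 * (N₁ : ℤ) - 1 → ∀ (a : ℕ) (μ : Fin S.n → ℕ), a + ∑ k, μ k < T' →
      ∑ T₁, |(S.halfClassVec R v B (S.pvΔ v pv c e μ) ((a, 0) : Tau S.n) s T₁ : ℝ)| ≤ Mb s a μ)
    (hfinal : ∀ s : ℤ, Odd s → |s| ≤ 2 * (N₁ : ℤ) - 1 → ∀ (a : ℕ) (μ : Fin S.n → ℕ), a + ∑ k, μ k < T' →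
      Real.exp (|γ| * (3 * N + 2)) *
          (2 * ((2 * N + 1 : ℕ) : ℝ) ^ (t + 1) * t * (20 * Real.exp 1) ^ ((2 * N + 1) * t) *
              ((2 * C) ^ t * Real.exp (|γ| * (N + 1)) *
                ((2 : ℝ) ^ a * Real.exp ((∑ k, A k * Γ k) / C) *
                  (Bc * PΔ * Wn * Real.exp ((|γ| + w) * N) * (2 * ((L S.j₀ : ℝ) * δ₀ * N))))) +
            Bc * PΔ * Wd * Real.exp ((w + (L S.j₀ : ℝ) * δ₀) * ((3 * E + 1) * (2 * N + 1) + N)) * (1 / E) ^ ((2 * N + 1) * t)) +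
        Bc * PΔ * Wh * Real.exp ((|γ| + w) * (3 * N + 2)) * (2 * ((L S.j₀ : ℝ) * δ₀ * (3 * N + 2))) <
      Mb s a μ / (4 * (D s a μ : ℝ) * Mb s a μ * heightProd S.α ^ 2) ^ (2 ^ S.n)) :
    ∃ i₀ ∈ B, pv i₀ ≠ 0 ∧
      S.ArchLvInv R' (S.parityClass v B i₀) (S.halfDiff v i₀) pv (fun j => -((v i₀ j - lo j) / 2)) (fun j => L j / 2) P (w / 2)
        ((γ - S.Lsum (v i₀)) / 2) c' e' {x : ℤ | Odd x ∧ |x| ≤ 2 * (N₁ : ℤ) - 1} T' := by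
  classical
  obtain ⟨i₀, hi₀B, hi₀⟩ := h.nonzero
  refine ⟨i₀, hi₀B, hi₀, ?_⟩
  have hsub := S.parityClass_subset v B i₀
  have hpar : ∀ i ∈ S.parityClass v B i₀, ∀ j, 2 ∣ v i j - v i₀ j := fun i hi => ((S.mem_parityClass v).mp hi).2
  -- common size facts
  have hL0 : 0 ≤ |γ| + w := by positivity
  have hδ : 0 ≤ |S.Λ / (S.b S.j₀ : ℝ)| := abs_nonneg _
  have hδ₀ : 0 ≤ δ₀ := hδ.trans hΛ
  have hV0 : (0 : ℝ) ≤ (L S.j₀ : ℝ) := Nat.cast_nonneg _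
  have hV₀ : ∀ i ∈ B, |(v i S.j₀ : ℝ)| ≤ (L S.j₀ : ℝ) := fun i hi => by exact_mod_cast h.abs_le i hi S.j₀
  have hN0 : (0 : ℝ) ≤ 3 * N + 2 := by positivity
  have hsmall' : (L S.j₀ : ℝ) * |S.Λ / (S.b S.j₀ : ℝ)| * (3 * N + 2) ≤ 1 :=
    le_trans (mul_le_mul_of_nonneg_right (mul_le_mul_of_nonneg_left hΛ hV0) hN0) hsmall
  have hEm : ∀ i ∈ B, |S.E (v i) - γ| ≤ w + (L S.j₀ : ℝ) * δ₀ := fun i hi =>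
    (h.abs_E_sub_le hV₀ i hi).trans (by nlinarith [mul_le_mul_of_nonneg_left hΛ hV0])
  have hBc0 : (0 : ℝ) ≤ B.card := Nat.cast_nonneg _
  have hBc0' : (0 : ℝ) ≤ Bc := hBc0.trans hBc
  refine ⟨⟨i₀, S.self_mem_parityClass v hi₀B, hi₀⟩, fun i hi => h.bound i (hsub hi),
    fun j => S.halfDiff_lo_le v h.lo_le (h.box i₀ hi₀B) j,
    fun i hi j => S.halfDiff_box v (hpar i hi) (h.box i (hsub hi)) (h.box i₀ hi₀B) j,
    fun i hi => S.abs_Lsum_halfDiff_sub_le v (hpar i hi) (h.slab i (hsub hi)), hc', ?_⟩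
  -- the Δ-vanishing of the new family at an odd node
  rintro s ⟨hso, hsN⟩ a μ' haμ'
  have hs : |s| ≤ 6 * (N : ℤ) + 4 := by omega
  have haT' : a < T' := by omega
  -- (1) separation: every class sum of `φ_{a,μ}` at `s/2` vanishes, for all `μ` with `a + |μ| < T′`
  have hsep : ∀ μ : Fin S.n → ℕ, ∑ k, μ k ≤ T' - 1 - a →
      S.halfClassVec R v B (S.pvΔ v pv c e μ) ((a, 0) : Tau S.n) s = 0 := by
    intro μ hμ
    have haμ : a + ∑ k, μ k < T' := by omega
    refine S.halfClassVec_pvΔ_eq_zero R v hind B pv h.c_ne e ht (fun x hx a' μ'' h' => h.vanish x hx a' μ'' h') (by omega) s hs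
      hA hΓ0 hΓ hPΔ0 (hPΔ a μ haμ) hE γ (fun i hi z hz => hWd i hi a haT' z hz) hWn0 hWn
      (fun i hi => hWh i hi a haT' s hso hsN) hL0 h.abs_Lsum_le hV0 hV₀ hsmall' hEm hC (hD s a μ) (hden s hso hsN a μ haμ)
      (hMb s a μ) (hsum s hso hsN a μ haμ) (lt_of_le_of_lt ?_ (hfinal s hso hsN a μ haμ))
    have hWd0 : 0 ≤ Wd := le_trans (norm_nonneg _) (hWd i₀ hi₀B a haT' 0 (by simp; positivity))
    gcongr
  -- (2) the pivot's class sum is a non-zero multiple of the re-indexed family's value at `s`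
  have hold : ∀ μ : Fin S.n → ℕ, ∑ k, μ k ≤ T' - 1 - a →
      S.archφ R' (S.halfDiff v i₀) (S.parityClass v B i₀) (S.pvΔ v pv c e μ) ((a, 0) : Tau S.n) s = 0 := by
    intro μ hμ
    have h1 := congrFun (hsep μ hμ) (S.oddSet (v i₀) s)
    rw [S.halfClassVec_pivot_eq R v B _ i₀ hso a (fun i hi => hRR' i hi a s)] at h1
    simp only [Pi.zero_apply, mul_eq_zero] at h1
    rcases h1 with (h1 | h1) | h1
    · exact absurd h1 (hca a)
    · exact absurd h1 (S.qEhZ_ne (v i₀) s)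
    · exact h1
  -- (3) change of Δ-basis to the new arguments
  exact S.archφ_pvΔ_rebase v (S.parityClass v B i₀) pv h.c_ne e (S.halfDiff v i₀) (v i₀)
    (fun i hi => S.eq_add_two_smul_halfDiff v (hpar i hi)) R' a s (T' - 1 - a) hold hc' e' μ' (by omega)

end ArchLvInv

end ArchG3Setup

end Summit.ABC.StewartYu

end
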